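import Summits.CriticalPhenomena.CardyFormulaZ2.Theorems.CardyMagicRigidityNestingRigidityNeckZ2Necklace
import HarnessLib

/-!
# Crux `NestingRigidity`, line `pinch-resampling` (v4), stub S12: node and arm certificates of a necklace

Crux `Summit.CriticalPhenomena.CardyFormulaZ2.Theses.CardyMagicRigidity.NestingRigidity`
(stmt-CriticalPhenomena-4835), line `pinch-resampling` v4, stub S12 `stub_neckHookupCoarseZ2 : NeckHookupCoarseZ2`.
Sequel of `…NeckZ2Necklace` (the necklace node event in normal form, `Necklace ω ℓ lam s x`): the two deterministic
certificates consumed by the glued bound `real_fourArm_and_armsIn_le` (`…NeckZ2NodeReimerRegion`) in the summation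
of `ZNodeAbsBoundChainA` (amended plan in the module docstring of `…NestingRigidityGapEntropy`, worker W6a).

* §1 **Node certificate** (`Necklace.exists_node_crossings`, registered anchor `necklace_node_certificate`).  Let a
  set `Q` of hop indices (a node of the hierarchy, read on the locales) be ISOLATED by the annulus `zAnn w r R`:
  locales of `Q` at sup distance `< r - ℓ` from `w`, the other locales at sup distance `≥ R + ℓ`, `1 ≤ r ≤ R ≤ s - 1`,
  `|w - x|_∞ ≤ s + 1`.  Take the FIRST RUN `[i₁, j₁]` of consecutive indices in `Q`; the clusters of `u i₁` (it meets
  `inn i₁`, near `p i₁ ∈ Q`, and is `b`'s far-reaching cluster or passes near `p (i₁ - 1) ∉ Q`) and of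
  `u (j₁ + 1) = out j₁` (near `p j₁ ∈ Q`; it is `b'`'s cluster or meets `inn (j₁ + 1)` near `p (j₁ + 1) ∉ Q`) both
  join the inside of `Λ_{r-1}(w)` to the outside of `Λ_{R-1}(w)` inside `Λ_{2s}(x)`, hence (crossing extraction
  `exists_zAnn_crossing_of_pathIn`) contain crossings `p₁ → q₁`, `p₂ → q₂` of `zAnn w r R`, not joined inside the
  annulus since `u i₁ ≁ u (j₁ + 1)` inside `Λ_{2s}(x) ⊇ zAnn w r R`.  The certificate also returns the run and the
  cluster identities `u i₁ ⟶ p₁`, `u (j₁ + 1) ⟶ p₂` (for the conflict analysis of the arms).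
* §2 **Arm certificate**: `Necklace.bigIdx i ∈ {i, i + 1}` is the index of the cluster through the locale `p i`
  (`path_u_bigIdx`, `bigIdx_eq_or`; at most two locales share a big cluster), and `Necklace.exists_far_point`: for
  every centre `c` and `2 R' ≤ lam` the locale `p i` is joined inside `Λ_{2s}(x)` to a point at sup distance `≥ R'`
  from `c` (one of the two ends of its big cluster) — the arm hypothesis `harm` of the glue for every annulus
  `zAnn c r' R'` with `|p i - c|_∞ < r'`.
-/

noncomputable section

namespace Summit.CriticalPhenomena.CardyFormulaZ2.Cruxes.NestingRigidity.PinchResampling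

open MeasureTheory Set Literature.Probability.Percolation Literature.Probability.LatticeModels
open ZPinchLocality
open NeckCoarseZ2

namespace Necklace

variable {ω : BondConfig (Site 2)} {ℓ lam s : ℕ} {x : Site 2} (N : Necklace ω ℓ lam s x)

/-! ## §1 The node certificate -/

/-- **First run of a set of indices**: if some index `< k` lies in `Q`, there is a run `[i₁, j₁] ⊆ Q`, `j₁ < k`, with
no index of `Q` before `i₁` and `j₁ + 1 ∉ Q` (or `j₁ + 1 = k`). -/
theorem exists_first_run {Q : ℕ → Prop} (hQ : ∃ i < N.k, Q i) :
    ∃ i₁ j₁, i₁ ≤ j₁ ∧ j₁ < N.k ∧ (∀ i, i₁ ≤ i → i ≤ j₁ → Q i) ∧ (∀ i < i₁, ¬ Q i) ∧ (j₁ + 1 < N.k → ¬ Q (j₁ + 1)) := by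
  classical
  -- the least index in `Q`
  have hex : ∃ i, i < N.k ∧ Q i := by
    obtain ⟨i, hi, hQi⟩ := hQ
    exact ⟨i, hi, hQi⟩
  set i₁ := Nat.find hex with hi₁
  obtain ⟨hi₁k, hQi₁⟩ := Nat.find_spec hex
  have hmin : ∀ i < i₁, ¬ Q i := fun i hi hQi ↦ Nat.find_min hex hi ⟨hi.trans hi₁k, hQi⟩
  -- the end of the run starting at `i₁`
  have hex' : ∃ j, i₁ ≤ j ∧ (j + 1 < N.k → ¬ Q (j + 1)) := ⟨N.k - 1, by omega, fun h ↦ by omega⟩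
  set j₁ := Nat.find hex' with hj₁
  obtain ⟨hij, hend⟩ := Nat.find_spec hex'
  have hrun : ∀ j, i₁ ≤ j → j < j₁ → j + 1 < N.k ∧ Q (j + 1) := fun j hj hjj ↦ by
    have h := Nat.find_min hex' hjj
    by_contra hcon
    exact h ⟨hj, fun hlt hQ ↦ hcon ⟨hlt, hQ⟩⟩
  have hj₁k : j₁ < N.k := by
    by_contra hcon
    have h := hrun (N.k - 1) (by omega) (by omega)
    omega
  refine ⟨i₁, j₁, hij, hj₁k, fun i hi hij' ↦ ?_, hmin, hend⟩
  rcases hi.eq_or_lt with rfl | hlt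
  · exact hQi₁
  · obtain ⟨i, rfl⟩ : ∃ i', i = i' + 1 := ⟨i - 1, by omega⟩
    exact (hrun i (by omega) (by omega)).2

/-- The square annulus of outer radius `R ≤ s - 1` around a point within `s + 1` of the centre lies in `Λ_{2s}(x)`. -/
theorem zAnn_subset_zBall_of_le {w : Site 2} (hw : zNorm (w - x) ≤ s + 1) {r R : ℕ} (hRs : R + 1 ≤ s) :
    zAnn w r R ⊆ zBall x (2 * s) := by
  intro z hz
  have h2 := zNorm_sub_le_add z w x
  have h3 := hz.2
  change zNorm (z - x) ≤ (2 * s : ℕ)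
  push_cast
  omega

/-- **Node certificate**: an annulus `zAnn w r R` isolating the locales of `Q` (inside `Λ_{r-ℓ-1}(w)`) from the other
locales (outside `Λ_{R+ℓ-1}(w)`) carries two open crossings in the clusters of `u i₁` and `u (j₁ + 1)`, `[i₁, j₁]` the
first run of `Q`, not joined inside the annulus (on a lattice configuration). -/
theorem exists_node_crossings (hHG : ∀ a b, (openGraph ω).Adj a b → (zdGraph 2).Adj a b) {Q : ℕ → Prop}
    (hQ : ∃ i < N.k, Q i) {w : Site 2} {r R : ℕ} (hrR : r ≤ R) (hRs : R + 1 ≤ s)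
    (hw : zNorm (w - x) ≤ s + 1) (hin : ∀ i < N.k, Q i → zNorm (N.p i - w) + ℓ < r)
    (hout : ∀ i < N.k, ¬ Q i → (R : ℤ) + ℓ ≤ zNorm (N.p i - w)) :
    ∃ i₁ j₁ p₁ q₁ p₂ q₂, i₁ ≤ j₁ ∧ j₁ < N.k ∧ (∀ i, i₁ ≤ i → i ≤ j₁ → Q i) ∧ (∀ i < i₁, ¬ Q i) ∧
      (j₁ + 1 < N.k → ¬ Q (j₁ + 1)) ∧
      zNorm (p₁ - w) = r ∧ zNorm (q₁ - w) = R ∧ zNorm (p₂ - w) = r ∧ zNorm (q₂ - w) = R ∧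
      PathIn (openGraph ω) (zAnn w r R) p₁ q₁ ∧ PathIn (openGraph ω) (zAnn w r R) p₂ q₂ ∧
      ¬ PathIn (openGraph ω) (zAnn w r R) p₁ p₂ ∧
      PathIn (openGraph ω) (zBall x (2 * s)) (N.u i₁) p₁ ∧
      PathIn (openGraph ω) (zBall x (2 * s)) (N.u (j₁ + 1)) p₂ := by
  obtain ⟨i₁, j₁, hij, hj₁k, hrun, hmin, hend⟩ := N.exists_first_run hQ
  set S := zBall x (2 * s) with hSdef
  have hAnnS : zAnn w r R ⊆ S := zAnn_subset_zBall_of_le hw hRs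
  have hi₁k : i₁ < N.k := by omega
  -- far points reach outside `Λ_{R-1}(w)`
  have hfar : ∀ y, zNorm (y - x) = 2 * s → (R : ℤ) ≤ zNorm (y - w) := fun y hy ↦ by
    have h := zNorm_sub_le_add y w x
    have h' : zNorm (y - w) = zNorm (w - y) := zNorm_sub_comm _ _
    have h'' := zNorm_sub_le_add w y x
    omega
  -- a locale outside `Q` keeps its `ℓ`-ball outside `Λ_{R-1}(w)`
  have houtball : ∀ i < N.k, ¬ Q i → ∀ y, zNorm (y - N.p i) < ℓ → (R : ℤ) ≤ zNorm (y - w) := by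
    intro i hi hQi y hy
    have h := hout i hi hQi
    have h1 := zNorm_sub_le_add (N.p i) y w
    have h2 : zNorm (N.p i - y) = zNorm (y - N.p i) := zNorm_sub_comm _ _
    omega
  -- a locale inside `Q` keeps its `ℓ`-ball inside `Λ_{r-1}(w)`
  have hinball : ∀ i < N.k, Q i → ∀ y, zNorm (y - N.p i) < ℓ → zNorm (y - w) < r := by
    intro i hi hQi y hy
    have h := hin i hi hQi
    have h1 := zNorm_sub_le_add y (N.p i) w
    omega
  -- the cluster of `u i₁`: from `inn i₁` (inside) to a far point
  have hU : ∃ q, (R : ℤ) ≤ zNorm (q - w) ∧ PathIn (openGraph ω) S (N.inn i₁) q := by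
    rcases Nat.eq_zero_or_pos i₁ with hz | hpos
    · obtain ⟨y, hy, hp⟩ := N.u_zero_far
      refine ⟨y, hfar y hy, ?_⟩
      have h := N.path_u_inn hi₁k
      rw [hz] at h ⊢
      exact h.symm.trans hp
    · obtain ⟨i, rfl⟩ : ∃ i, i₁ = i + 1 := ⟨i₁ - 1, by omega⟩
      refine ⟨N.u (i + 1), ?_, (N.path_u_inn hi₁k).symm⟩
      rw [u_succ]
      exact houtball i (by omega) (hmin i (by omega)) _ (N.out_near i (by omega))
  -- the cluster of `u (j₁ + 1) = out j₁`: from `out j₁` (inside) to a far point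
  have hV : ∃ q, (R : ℤ) ≤ zNorm (q - w) ∧ PathIn (openGraph ω) S (N.out j₁) q := by
    by_cases hlast : j₁ + 1 < N.k
    · refine ⟨N.inn (j₁ + 1), houtball (j₁ + 1) hlast (hend hlast) _ (N.inn_near _ hlast), ?_⟩
      have h := N.path_u_inn hlast
      rwa [u_succ] at h
    · obtain ⟨y, hy, hp⟩ := N.u_last_far
      have hk : N.k = j₁ + 1 := by omega
      rw [hk, u_succ] at hp
      exact ⟨y, hfar y hy, hp⟩
  obtain ⟨qU, hqU, hpU⟩ := hU
  obtain ⟨qV, hqV, hpV⟩ := hV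
  have hinnU : zNorm (N.inn i₁ - w) < r := hinball i₁ hi₁k (hrun i₁ le_rfl hij) _ (N.inn_near i₁ hi₁k)
  have houtV : zNorm (N.out j₁ - w) < r := hinball j₁ hj₁k (hrun j₁ hij le_rfl) _ (N.out_near j₁ hj₁k)
  obtain ⟨p₁, q₁, hp₁, hq₁, hc₁, hcp₁⟩ := exists_zAnn_crossing_of_pathIn hHG hrR hinnU hqU hpU
  obtain ⟨p₂, q₂, hp₂, hq₂, hc₂, hcp₂⟩ := exists_zAnn_crossing_of_pathIn hHG hrR houtV hqV hpV
  have hSA : S ∩ zAnn w r R = zAnn w r R := inter_eq_right.2 hAnnS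
  rw [hSA] at hc₁ hc₂
  have hu₁ : PathIn (openGraph ω) S (N.u i₁) p₁ := (N.path_u_inn hi₁k).trans hcp₁
  have hu₂ : PathIn (openGraph ω) S (N.u (j₁ + 1)) p₂ := by rw [u_succ]; exact hcp₂
  refine ⟨i₁, j₁, p₁, q₁, p₂, q₂, hij, hj₁k, hrun, hmin, hend, hp₁, hq₁, hp₂, hq₂, hc₁, hc₂, fun h ↦ ?_, hu₁, hu₂⟩
  exact N.not_path_u_u (show i₁ < j₁ + 1 by omega) (by omega) ((hu₁.trans (h.mono hAnnS)).trans hu₂.symm)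

/-! ## §2 The arm certificate -/

/-- **Index of the big cluster through the locale `p i`**: `i` if `p i = inn i` (the cluster of `u i`), else `i + 1`
(the cluster of `u (i + 1) = out i`). -/
def bigIdx (i : ℕ) : ℕ := by
  classical
  exact if N.p i = N.inn i then i else i + 1

/-- `bigIdx i ∈ {i, i + 1}` — whence at most two locales share a big cluster. -/
theorem bigIdx_eq_or (i : ℕ) : N.bigIdx i = i ∨ N.bigIdx i = i + 1 := by
  unfold bigIdx
  split_ifs
  · exact Or.inl rfl
  · exact Or.inr rfl

/-- `bigIdx i ≤ k` for `i < k`. -/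
theorem bigIdx_le {i : ℕ} (hi : i < N.k) : N.bigIdx i ≤ N.k := by
  rcases N.bigIdx_eq_or i with h | h <;> omega

/-- **The locale `p i` lies in the cluster of `u (bigIdx i)`.** -/
theorem path_u_bigIdx {i : ℕ} (hi : i < N.k) : PathIn (openGraph ω) (zBall x (2 * s)) (N.u (N.bigIdx i)) (N.p i) := by
  unfold bigIdx
  split_ifs with h
  · rw [h]
    exact N.path_u_inn hi
  · rcases N.p_eq i hi with h' | h'
    · exact absurd h' h
    · rw [u_succ, ← h']
      exact PathIn.refl (N.p_mem i hi).1.1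

/-- `bigIdx` is at most two-to-one: `bigIdx i = bigIdx j` forces `j ≤ i + 1` and `i ≤ j + 1`. -/
theorem bigIdx_eq_bigIdx {i j : ℕ} (h : N.bigIdx i = N.bigIdx j) : i = j ∨ i + 1 = j ∨ j + 1 = i := by
  rcases N.bigIdx_eq_or i with hi | hi <;> rcases N.bigIdx_eq_or j with hj | hj <;> omega

/-- **Arm certificate**: for every centre `c` and `2 R' ≤ lam`, the locale `p i` is joined inside `Λ_{2s}(x)` to a
point at sup distance `≥ R'` from `c` (one of the two ends of its big cluster). -/
theorem exists_far_point {i : ℕ} (hi : i < N.k) (c : Site 2) {R' : ℕ} (hR' : 2 * R' ≤ lam) :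
    ∃ q, (R' : ℤ) ≤ zNorm (q - c) ∧ PathIn (openGraph ω) (zBall x (2 * s)) (N.p i) q := by
  obtain ⟨w, w', hd, hw, hw'⟩ := N.big i hi
  have h1 := zNorm_sub_le_add w c w'
  have h2 : zNorm (c - w') = zNorm (w' - c) := zNorm_sub_comm _ _
  by_cases hwc : (R' : ℤ) ≤ zNorm (w - c)
  · exact ⟨w, hwc, hw⟩
  · refine ⟨w', ?_, hw'⟩
    have : (2 * R' : ℤ) ≤ lam := by exact_mod_cast hR'
    omega

/-- **Arm hypothesis of the glue**: for an annulus `zAnn c r' R'` with `|p i - c|_∞ < r'` and `2 R' ≤ lam`, the locale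
`p i` starts an arm: `|p i - c|_∞ < r'` and it is joined inside `Λ_{2s}(x)` to sup distance `≥ R'` from `c`. -/
theorem arm_hypothesis {i : ℕ} (hi : i < N.k) {c : Site 2} {r' R' : ℕ} (hc : zNorm (N.p i - c) < r')
    (hR' : 2 * R' ≤ lam) :
    zNorm (N.p i - c) < r' ∧ ∃ q, (R' : ℤ) ≤ zNorm (q - c) ∧ PathIn (openGraph ω) (zBall x (2 * s)) (N.p i) q :=
  ⟨hc, N.exists_far_point hi c hR'⟩

/-- **Cluster exemption of an arm from a node**: if the big cluster of `p i` is neither the cluster of `u a` nor that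
of `u a'` (`bigIdx i ∉ {a, a'}`, all indices `≤ k`), then `p i` is joined inside `Λ_{2s}(x)` to no point of these two
clusters. -/
theorem not_path_p_of_bigIdx_ne {i a a' : ℕ} (hi : i < N.k) (ha : a ≤ N.k) (ha' : a' ≤ N.k) (hne : N.bigIdx i ≠ a)
    (hne' : N.bigIdx i ≠ a') {p₁ p₂ : Site 2} (hp₁ : PathIn (openGraph ω) (zBall x (2 * s)) (N.u a) p₁)
    (hp₂ : PathIn (openGraph ω) (zBall x (2 * s)) (N.u a') p₂) :
    ¬ PathIn (openGraph ω) (zBall x (2 * s)) (N.p i) p₁ ∧ ¬ PathIn (openGraph ω) (zBall x (2 * s)) (N.p i) p₂ :=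
  ⟨fun h ↦ N.not_path_u_u' hne (N.bigIdx_le hi) ha (((N.path_u_bigIdx hi).trans h).trans hp₁.symm),
    fun h ↦ N.not_path_u_u' hne' (N.bigIdx_le hi) ha' (((N.path_u_bigIdx hi).trans h).trans hp₂.symm)⟩

/-- **Distinct big clusters give arms separated by cluster**: if `bigIdx i ≠ bigIdx j` then `p i ≁ p j` inside
`Λ_{2s}(x)`. -/
theorem not_path_p_p {i j : ℕ} (hi : i < N.k) (hj : j < N.k) (hne : N.bigIdx i ≠ N.bigIdx j) :
    ¬ PathIn (openGraph ω) (zBall x (2 * s)) (N.p i) (N.p j) := fun h ↦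
  N.not_path_u_u' hne (N.bigIdx_le hi) (N.bigIdx_le hj)
    (((N.path_u_bigIdx hi).trans h).trans (N.path_u_bigIdx hj).symm)

end Necklace

/-- **Node certificate of a necklace (registered helper, anchor of this module on the crux item)**: on a lattice
configuration, an annulus `zAnn w r R` (`r ≤ R ≤ s - 1`, `|w - x|_∞ ≤ s + 1`) keeping the locales of a nonempty index
set `Q` inside `Λ_{r-ℓ-1}(w)` and the others outside `Λ_{R+ℓ-1}(w)` carries two open crossings, in the clusters of
`u i₁` and `u (j₁ + 1)` for the first run `[i₁, j₁]` of `Q`, not joined inside the annulus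
(`Necklace.exists_node_crossings`). -/
theorem necklace_node_certificate : ∀ (ℓ lam s : ℕ) (x : Site 2) (ω : BondConfig (Site 2)) (N : Necklace ω ℓ lam s x), (∀ a b, (openGraph ω).Adj a b → (zdGraph 2).Adj a b) → ∀ (Q : ℕ → Prop) (w : Site 2) (r R : ℕ), (∃ i < N.k, Q i) → r ≤ R → R + 1 ≤ s → zNorm (w - x) ≤ s + 1 → (∀ i < N.k, Q i → zNorm (N.p i - w) + ℓ < r) → (∀ i < N.k, ¬ Q i → (R : ℤ) + ℓ ≤ zNorm (N.p i - w)) → ∃ i₁ j₁ p₁ q₁ p₂ q₂, i₁ ≤ j₁ ∧ j₁ < N.k ∧ (∀ i, i₁ ≤ i → i ≤ j₁ → Q i) ∧ (∀ i < i₁, ¬ Q i) ∧ (j₁ + 1 < N.k → ¬ Q (j₁ + 1)) ∧ zNorm (p₁ - w) = r ∧ zNorm (q₁ - w) = R ∧ zNorm (p₂ - w) = r ∧ zNorm (q₂ - w) = R ∧ PathIn (openGraph ω) (NeckCoarseZ2.zAnn w r R) p₁ q₁ ∧ PathIn (openGraph ω) (NeckCoarseZ2.zAnn w r R) p₂ q₂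 ∧ ¬ PathIn (openGraph ω) (NeckCoarseZ2.zAnn w r R) p₁ p₂ ∧ PathIn (openGraph ω) (zBall x (2 * s)) (N.u i₁) p₁ ∧ PathIn (openGraph ω) (zBall x (2 * s)) (N.u (j₁ + 1)) p₂ :=
  fun _ _ _ _ _ N hHG _ _ _ _ hQ hrR hRs hw hin hout ↦ N.exists_node_crossings hHG hQ hrR hRs hw hin hout

end Summit.CriticalPhenomena.CardyFormulaZ2.Cruxes.NestingRigidity.PinchResampling

end
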